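import Summits.Ventures.HodgeRepro2.T5BergmanIntegrableSharpU11
import Summits.Ventures.HodgeRepro2.T5SU11CoefficientPow

/-!
# The `L^p` norms of the lowest-weight coefficient in closed form

`T5SU11CoefficientPow` computed Rühl's integral `∫_G cosh(η/2)^{-3p} dμ_R = 2/(3p - 2)` (`p > 2/3`) in
the parametrisation `coeffPow p g = (1 - |g·0|²)^{3p/2}`. Since `coeffPow p g = |a(g)|^{-3p}`
(`coeffPow_eq_norm_mat_inv_rpow`), this is the closed form of the threshold integrals of
`T5BergmanIntegrableSharp` for every real exponent:

  `∫_G |a(g)|^{-s} dμ_R = 2 / (s - 2)`   (`s > 2`; `integral_norm_mat_inv_rpow_ruhl`),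

`μ_R = π⁻¹ ν` Rühl's normalisation of the Haar measure of `SU(1,1)`, and `2π/(s - 2)` against `ν`.
With `|⟨π_k(g) 1, 1⟩_k| = (π/(k-1)) |a(g)|^{-k}` this gives the `L^p` norm of the lowest-weight matrix
coefficient of the weight-`k` model for every `p` with `k p > 2`:

  `∫_G |⟨π_k(g) 1, 1⟩_k|^p dμ_R = (π/(k-1))^p · 2/(k p - 2)`   (`integral_norm_matrixCoeff_lowest_lowest_rpow_ruhl`),

`p = 2` being the Schur relation `(π/(k-1))²/(k-1)` of `T5BergmanSchur` (formal degree `k - 1` against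
`μ_R`), `p = 1` the `L¹` norm `2π/((k-1)(k-2))` of the integrable members `k ≥ 3`; and, on
`H_j = U(1,1)`, `c_U · ∫_{U(1,1)} |⟨π_k(g) 1, 1⟩_k|^p dμ_U = (π/(k-1))^p · 2π/(k p - 2)` with the
positive normalisation constant `c_U` of the product formula (`integral_norm_matrixCoeffU_lowest_lowest_rpow`).
Nothing is claimed about (N).

Blind lane: Mathlib + the HodgeRepro2 prefix only; no sorry; axioms ⊆ {propext, Classical.choice,
Quot.sound}.
-/

namespace Summit.Ventures.HodgeRepro2.T5BergmanCoefficientLpNorm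

open MeasureTheory MeasureTheory.Measure Metric Filter Topology Set
open T5PoincareDensity T5PoincareMeasure T5SU11Unimodular T5U11Unimodular T5U11Product
  T5SU11Fibration T5SU11FibrationHaar T5SU11FibrationCartan T5HaarCircle T5SU11CoefficientL2
  T5SU11CoefficientPow
open T5BergmanCoefficient T5BergmanPairing T5BergmanFourier T5BergmanParseval T5BergmanActStable
  T5BergmanMatrixCoeff T5BergmanSchur T5BergmanKTypeMatrix T5BergmanIntegrableCoeff
  T5BergmanProjection T5BergmanDiscThreshold T5BergmanIntegrableSharp T5BergmanU11
  T5BergmanSchurGeneralU11 T5BergmanIntegrableKFinite T5BergmanCoefficientLp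
  T5BergmanIntegrableSharpU11
open scoped Real ENNReal NNReal

/-! ### `coeffPow` is `|a(g)|^{-3p}` -/

/-- `coeffPow p g = (1 - |g·0|²)^{3p/2} = |a(g)|^{-3p}`. -/
theorem coeffPow_eq_norm_mat_inv_rpow (p : ℝ) (g : SU11) :
    coeffPow p g = ‖mat g 0 0‖⁻¹ ^ (3 * p) := by
  unfold coeffPow
  rw [one_sub_norm_orbit_sq, ← Real.rpow_natCast _ 2, ← Real.rpow_mul (by positivity)]
  congr 1
  push_cast
  ring

/-- `|a(g)|^{-s} = coeffPow (s/3) g`. -/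
theorem norm_mat_inv_rpow_eq_coeffPow (s : ℝ) (g : SU11) :
    ‖mat g 0 0‖⁻¹ ^ s = coeffPow (s / 3) g := by
  rw [coeffPow_eq_norm_mat_inv_rpow]
  congr 1
  ring

/-! ### Pointwise identities -/

/-- `|⟨π_k(g) 1, 1⟩_k|^p = (π/(k-1))^p · |a(g)|^{-kp}` for `k ≥ 2`. -/
theorem norm_matrixCoeff_lowest_lowest_rpow (k : ℕ) (hk : 2 ≤ k) (p : ℝ) (g : SU11) :
    ‖matrixCoeff k lowest lowest g‖ ^ p =
      (π / ((k : ℝ) - 1)) ^ p * ‖mat g 0 0‖⁻¹ ^ ((k : ℝ) * p) := by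
  have hk1 : (1 : ℝ) < k := by exact_mod_cast (by omega : 1 < k)
  have hc : (0 : ℝ) < π / ((k : ℝ) - 1) := div_pos Real.pi_pos (by linarith)
  rw [norm_matrixCoeff_lowest_lowest k hk g, Real.mul_rpow hc.le (by positivity),
    ← Real.rpow_natCast _ k, ← Real.rpow_mul (by positivity)]

/-- `|⟨π_k(g) f, h⟩_k|^p` on `U(1,1)` is invariant under the centre. -/
lemma norm_matrixCoeffU_rpow_scalarHom_mul (k : ℕ) (f h : ℂ → ℂ) (p : ℝ) (lam : Circle) (g : U11) :
    ‖matrixCoeffU k f h (scalarHom lam * g)‖ ^ p = ‖matrixCoeffU k f h g‖ ^ p := by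
  have h2 := norm_matrixCoeffU_sq_scalarHom_mul k f h lam g
  have e : ‖matrixCoeffU k f h (scalarHom lam * g)‖ = ‖matrixCoeffU k f h g‖ :=
    (pow_left_inj₀ (norm_nonneg _) (norm_nonneg _) two_ne_zero).mp h2
  rw [e]

variable [MeasurableSpace Circle] [BorelSpace Circle]

/-! ### The closed form of `∫_G |a(g)|^{-s}` -/

/-- `∫_G |a(g)|^{-s} dν = 2π / (s - 2)` for `s > 2` (`ν = Φ_*(poincare ⊗ haarCircle)`). -/
theorem integral_norm_mat_inv_rpow_nu {s : ℝ} (hs : 2 < s) :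
    ∫ g, ‖mat g 0 0‖⁻¹ ^ s ∂(nu haarCircle) = 2 * π / (s - 2) := by
  simp_rw [norm_mat_inv_rpow_eq_coeffPow s]
  rw [integral_coeffPow_nu (s / 3) (by linarith)]
  congr 1
  ring

/-- **`∫_G |a(g)|^{-s} dμ_R = 2 / (s - 2)`** for every real `s > 2`, against Rühl's normalisation
`μ_R = π⁻¹ ν` of the Haar measure of `SU(1,1)` (Rühl's `2/(3p - 2)` at `s = 3p`). -/
theorem integral_norm_mat_inv_rpow_ruhl {s : ℝ} (hs : 2 < s) :
    ∫ g, ‖mat g 0 0‖⁻¹ ^ s ∂ruhl = 2 / (s - 2) := by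
  simp_rw [norm_mat_inv_rpow_eq_coeffPow s]
  rw [integral_coeffPow_ruhl (s / 3) (by linarith)]
  congr 1
  ring

/-- For every Haar measure `μ` of `SU(1,1)`: `c • ∫_G |a(g)|^{-s} dμ = 2π / (s - 2)`,
`c = haarScalarFactor ν μ > 0`. -/
theorem integral_norm_mat_inv_rpow_eq (μ : Measure SU11) [IsHaarMeasure μ] {s : ℝ} (hs : 2 < s) :
    (haarScalarFactor (nu haarCircle) μ : ℝ) • ∫ g, ‖mat g 0 0‖⁻¹ ^ s ∂μ = 2 * π / (s - 2) := by
  simp_rw [norm_mat_inv_rpow_eq_coeffPow s]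
  rw [integral_coeffPow μ (s / 3) (by linarith)]
  congr 1
  ring

/-! ### The `L^p` norms of the lowest-weight coefficient -/

/-- **The `L^p` norm of the lowest-weight coefficient**: for `k ≥ 2` and `k p > 2`,
`∫_G |⟨π_k(g) 1, 1⟩_k|^p dμ_R = (π/(k-1))^p · 2/(kp - 2)` (`p = 2`: the Schur relation
`(π/(k-1))²/(k-1)`; `p = 1`, `k ≥ 3`: the `L¹` norm `2π/((k-1)(k-2))`). -/
theorem integral_norm_matrixCoeff_lowest_lowest_rpow_ruhl (k : ℕ) (hk : 2 ≤ k) {p : ℝ}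
    (hkp : 2 < (k : ℝ) * p) :
    ∫ g, ‖matrixCoeff k lowest lowest g‖ ^ p ∂ruhl =
      (π / ((k : ℝ) - 1)) ^ p * (2 / ((k : ℝ) * p - 2)) := by
  simp_rw [norm_matrixCoeff_lowest_lowest_rpow k hk p]
  rw [integral_const_mul, integral_norm_mat_inv_rpow_ruhl hkp]

/-- The same against every Haar measure `μ` of `SU(1,1)`, with the scalar `c = haarScalarFactor ν μ`. -/
theorem integral_norm_matrixCoeff_lowest_lowest_rpow (μ : Measure SU11) [IsHaarMeasure μ] (k : ℕ)
    (hk : 2 ≤ k) {p : ℝ} (hkp : 2 < (k : ℝ) * p) :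
    (haarScalarFactor (nu haarCircle) μ : ℝ) • ∫ g, ‖matrixCoeff k lowest lowest g‖ ^ p ∂μ =
      (π / ((k : ℝ) - 1)) ^ p * (2 * π / ((k : ℝ) * p - 2)) := by
  simp_rw [norm_matrixCoeff_lowest_lowest_rpow k hk p]
  rw [integral_const_mul, smul_eq_mul]
  have h := integral_norm_mat_inv_rpow_eq μ hkp
  rw [smul_eq_mul] at h
  rw [← h]
  ring

/-- The `L¹` norm of the lowest-weight coefficient of an integrable member `k ≥ 3`:
`∫_G |⟨π_k(g) 1, 1⟩_k| dμ_R = 2π / ((k-1)(k-2))`. -/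
theorem integral_norm_matrixCoeff_lowest_lowest_ruhl (k : ℕ) (hk : 3 ≤ k) :
    ∫ g, ‖matrixCoeff k lowest lowest g‖ ∂ruhl = 2 * π / (((k : ℝ) - 1) * ((k : ℝ) - 2)) := by
  have h := integral_norm_matrixCoeff_lowest_lowest_rpow_ruhl k (by omega) (p := 1) (by
    have : (3 : ℝ) ≤ k := by exact_mod_cast hk
    linarith)
  simp only [Real.rpow_one, mul_one] at h
  rw [h]
  have hk1 : (1 : ℝ) < k := by exact_mod_cast (by omega : 1 < k)
  have hk2 : (2 : ℝ) < k := by exact_mod_cast (by omega : 2 < k)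
  field_simp

variable [MeasurableSpace U11] [BorelSpace U11]

/-! ### On `H_j = U(1,1)` -/

/-- **The `L^p` norm on `H_j = U(1,1)`**: `c_U • ∫_{U(1,1)} |⟨π_k(g) 1, 1⟩_k|^p dμ_U =
(π/(k-1))^p · 2π/(kp - 2)` for `k ≥ 2`, `k p > 2` and every Haar measure `μ_U` of `U(1,1)`,
`c_U = haarScalarFactor (map mulHom (haarCircle ⊗ ν)) μ_U > 0`. -/
theorem integral_norm_matrixCoeffU_lowest_lowest_rpow (μU : Measure U11) [IsHaarMeasure μU] (k : ℕ)
    (hk : 2 ≤ k) {p : ℝ} (hp : 0 < p) (hkp : 2 < (k : ℝ) * p) :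
    (haarScalarFactor (map mulHom (haarCircle.prod (nu haarCircle))) μU : ℝ) •
      ∫ g, ‖matrixCoeffU k lowest lowest g‖ ^ p ∂μU =
        (π / ((k : ℝ) - 1)) ^ p * (2 * π / ((k : ℝ) * p - 2)) := by
  have hint : Integrable (fun g => ‖matrixCoeffU k lowest lowest g‖ ^ p) μU := by
    have hU := continuous_matrixCoeffU_of_differentiableOn k hk lowest (differentiableOn_const 1)
      (integrableOn_lowest k) lowest (differentiableOn_const 1) (integrableOn_lowest k)
    exact (memLp_ofReal_iff_integrable_norm_rpow hU.aestronglyMeasurable hp).mp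
      ((memLp_matrixCoeffU_lowest_lowest_iff μU k hk hp).mpr hkp)
  rw [integral_eq_of_scalar_invariant haarCircle (nu haarCircle) μU _ hint
    (norm_matrixCoeffU_rpow_scalarHom_mul k lowest lowest p), haarCircle_univ, ENNReal.toReal_one,
    one_smul]
  simp_rw [matrixCoeffU_incl]
  have h := integral_norm_matrixCoeff_lowest_lowest_rpow (nu haarCircle) k hk hkp
  rw [haarScalarFactor_self, NNReal.coe_one, one_smul] at h
  exact h

end Summit.Ventures.HodgeRepro2.T5BergmanCoefficientLpNorm
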